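import Literature.NumberTheory.Weil1964.ArchDualPairThetaMajorantsInrConj
import Literature.NumberTheory.GelbartRogawski1991.UnitaryDualPairSplittingDatumCongruenceTransport
import Literature.NumberTheory.GelbartRogawski1991.Prop311RecordShapesHold
import Literature.NumberTheory.Automorphic.QuadExtPlacesAbove
import HarnessLib

/-!
# H413 · E-2 · SW2 (iii) — row SW2c-BOUND: transport of a Lemme-5-dominated implementer hom along an `F`-rational CONGRUENCE of the
# Gram data (the engine behind the (IMPL)+(DOM-C) letter for an ARBITRARY symmetric `T_V`)

Cell `hodgecm-mathlib`, floor 0, programme P4, engine E-2, crux H413 (`stmt-HodgeConjecture-24833`, `--supports`); child line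
`Cruxes/H413/Lines/F0_E2SiegelWeilWeilRange.lean`, open stub `stub_SW2iii_siegelWeil`; row «A6 INPUT ADAPTER ∕ hdom_CM» of F0P4-plan (g4)
2026-08-31T05:20:53Z; seat F0P4-p05 (g3).  PROOF lane: theorems only, no definition, no notation, no `sorry`.  HC_CM is proved only modulo
the printed citations until rung 0 closes; nothing here is about Hodge classes.  Consumer: the sibling `Theorems/H413E2SWBorelBoundLettersCM.lean`.

WHAT THIS FILE DOES.  The producers of A4's letter `hIMPL` — A-p12's ★ `adelicMpCont.exists_pos_le_l2Scaling_conj_comp_of_isCompact` and B-p12's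
Lemme 5 ★ `exists_piSchwartzBruhat_dominating_omega_conj_pairSplitting_inr_of_signs` — want a CONTINUOUS HOMOMORPHIC implementer
`U_D(𝔸_F) →* Mp_ψ(𝕎□_𝔸)ᶜᵒⁿᵗ`, and Lemme 5 is in the tree for DIAGONAL Gram data `(diag t_V, diag t_W)` only.  §1 (generic symmetric
`(T_V, T_W)`, congruence `P = P_V ⊗ 1`): along the GR lane's ★ rational congruence transport `φ = congrMp` (= relabelling ∘ conjugation by
Weil's Levi pair of `P_V ⊗ 1`, [MoeglinVignerasWaldspurger1987, Chap. 2 II.1]) one has `eG(1 ⊗ k) = 1 ⊗ k` (`congrPair_adelicInr`), the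
transported value of a compatible splitting lies over `ι′(1 ⊗ ·)` (`proj_congrMp_splitting_apply`, by ★ `toSp_congr` and ★ `proj_congrMp`), and
`ω(ũ · φ(y) · ũ⁻¹) = ω(q · y · q⁻¹)` with the FIXED `q = R⁻¹ũ · q_L` (`omega_conj_congrMp`; the relabelling does not move the operator,
★ `adelicMpCont.omega_relabel`).  §2 (diagonal data): B-p12's Lemme 5 at `(diag t_V, diag t_W)` with that fixed conjugator gives ONE
dominating `Φ₀` for `{ω(ũ · φ(s(eG(1 ⊗ k))) · ũ⁻¹)Φ : k ∈ C}` (`exists_dominating_conj_congrMp_splitting`), whence the implementer hom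
`S := φ ∘ s ∘ eG ∘ (1 ⊗ ·)` at the congruent data `(P_Vᵀ diag(t_V) P_V, 1ᵀ diag(t_W) 1)` — continuous, over `ι′(1 ⊗ ·)`, Lemme-5-dominated
(`exists_implementerHom_diagonal`, `s` = ★ `UnitaryDualPair.compatibleSplitting_splittingDatum` [GelbartRogawski1991, Prop. 3.1.1]) — and its
EQUATION-BINDER form `exists_implementerHom_of_congr` (target data and Gram matrix entered as equations, `subst`).  Elaboration note: every
`1 : Matrix` is type-ascribed (a bare trailing `1` in `1ᵀ · T · 1` elaborates as a cast and defeats unification), and all algebra on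
`Mp`-valued terms is term-mode (`Eq.trans`∕`congrArg`), never `rw`∕`obtain` on those carriers.

References: A. Weil, *Sur certains groupes d'opérateurs unitaires*, Acta Math. 111 (1964), Chap. I n° 13 p. 160, Chap. III n° 41
Lemme 5 p. 194 [Weil1964]; A. Weil, *Sur la formule de Siegel dans la théorie des groupes classiques*, Acta Math. 113 (1965), n° 47
Lemme 20, n° 50 [Weil1965]; S. Gelbart, J. Rogawski, Invent. Math. 105 (1991), §3.1 p. 454 L21–42, Prop. 3.1.1 p. 455 [GelbartRogawski1991];
C. Mœglin, M.-F. Vignéras, J.-L. Waldspurger, LNM 1291 (1987), Chap. 2 II.1 (A)–(B) [MoeglinVignerasWaldspurger1987]; J.-P. Serre,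
*A Course in Arithmetic*, GTM 7 (1973), Ch. IV §1.4 [Serre1973].
-/

set_option autoImplicit false
-- the cell's `Summit.HodgeConjecture.HodgeConjecture.…` namespace repeats the summit name by design (D-0017 layout)
set_option linter.dupNamespace false

noncomputable section

open scoped NNReal ENNReal Matrix Kronecker
open _root_.MeasureTheory NumberField NumberField.InfinitePlace IsDedekindDomain Matrix
open Literature.RepresentationTheory.HeisenbergGroup
open Literature.NumberTheory.Weil1964 Literature.NumberTheory.Automorphic
open Literature.NumberTheory.Automorphic.UnitaryGroup
open Literature.NumberTheory.GelbartRogawski1991 Literature.NumberTheory.GelbartRogawski1991.UnitaryDualPair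

namespace Summit.HodgeConjecture.HodgeConjecture.Cruxes.H413.E2SWBorelBoundLettersCongr

/-! ## §1 Transport of an implementer along an `F`-rational congruence of the Gram data (`P_W = 1`) -/

section Congr

variable (F E : Type) [Field F] [NumberField F] [Field E] [NumberField E] [Algebra F E] [Algebra.IsQuadraticExtension F E]
  (c : E ≃ₐ[F] E) {δ : E} (hcδ : c δ = -δ) (hδ : δ ≠ 0) {d : F} (hd : δ * δ = algebraMap F E d)
  (N M : ℕ) {m : ℕ} (eD : Fin N × Fin M ≃ Fin m)
  {TV : Matrix (Fin N) (Fin N) F} {TW : Matrix (Fin M) (Fin M) F} (hV : TV.IsSymm) (hW : TW.IsSymm)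
  (hVd : IsUnit TV.det) (hWd : IsUnit TW.det)
  {PV : Matrix (Fin N) (Fin N) F} (hPV : IsUnit PV.det) (hPW : IsUnit (1 : Matrix (Fin M) (Fin M) F).det)

omit [NumberField F] [Algebra.IsQuadraticExtension F E] in
include hcδ hδ in
/-- `c ≠ 1`: `c δ = -δ` with `δ ≠ 0` in characteristic zero. [folklore] -/
theorem conj_ne_one : c ≠ 1 := by
  intro h
  apply hδ
  have h2 : c δ = δ := by rw [h]; rfl
  rw [hcδ] at h2
  have h3 : (2 : E) * δ = 0 := by rw [two_mul]; nth_rewrite 1 [← h2]; exact neg_add_cancel δ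
  rcases mul_eq_zero.1 h3 with h4 | h4
  · exact absurd h4 two_ne_zero
  · exact h4

omit [Algebra.IsQuadraticExtension F E] in
/-- **`eG (1 ⊗ k) = 1 ⊗ k`** for the congruence `P = P_V ⊗ 1` (`P_W = 1`): `P_V ⊗ 1` commutes with `1 ⊗ k`, so the conjugation
`g ↦ P g P⁻¹` of ★ `congrPair` fixes the second member of the dual pair (same matrix `k`, read in `U(T_W)` and in `U(1ᵀ T_W 1)`).
[cite: GelbartRogawski1991, §3.1 p. 454 L41–42] -/
theorem congrPair_adelicInr
    (k : ↥(UnitaryGroup.adelic F E c M (((1 : Matrix (Fin M) (Fin M) F)ᵀ * TW * (1 : Matrix (Fin M) (Fin M) F)).map (algebraMap F E))))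
    (k' : ↥(UnitaryGroup.adelic F E c M (TW.map (algebraMap F E))))
    (hkk : (k : GL (Fin M) (AdeleRing (𝓞 E) E)) = k') :
    congrPair F E c N M hPV hPW TV TW (adelicInr F E c N M _ _ k) = adelicInr F E c N M _ _ k' := by
  have hmat : ((kronGLAdele F E N M hPV hPW : GL (Fin N × Fin M) (AdeleRing (𝓞 E) E)) :
          Matrix (Fin N × Fin M) (Fin N × Fin M) (AdeleRing (𝓞 E) E)) *
        ((1 : Matrix (Fin N) (Fin N) (AdeleRing (𝓞 E) E)) ⊗ₖ
          ((k : GL (Fin M) (AdeleRing (𝓞 E) E)) : Matrix (Fin M) (Fin M) (AdeleRing (𝓞 E) E))) =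
      ((1 : Matrix (Fin N) (Fin N) (AdeleRing (𝓞 E) E)) ⊗ₖ
          ((k' : GL (Fin M) (AdeleRing (𝓞 E) E)) : Matrix (Fin M) (Fin M) (AdeleRing (𝓞 E) E))) *
        ((kronGLAdele F E N M hPV hPW : GL (Fin N × Fin M) (AdeleRing (𝓞 E) E)) :
          Matrix (Fin N × Fin M) (Fin N × Fin M) (AdeleRing (𝓞 E) E)) := by
    rw [coe_kronGLAdele, ← hkk]
    simp only [← UnitaryGroup.kronecker_map_map, Matrix.map_one, map_zero, map_one]
    rw [← Matrix.mul_kronecker_mul, ← Matrix.mul_kronecker_mul]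
    simp only [Matrix.one_mul, Matrix.mul_one]
  apply Subtype.ext
  rw [coe_congrPair_apply, mul_inv_eq_iff_eq_mul]
  exact Units.ext hmat

/-- **`π′(φ(s(eG(1 ⊗ k)))) = ι′(1 ⊗ k)`** as automorphisms of `𝕎_𝔸`: the transported value of a compatible splitting `s` lies over
`ι′` (`π′ ∘ φ = eSp ∘ π` ★ `proj_congrMp`, `π ∘ s = ι`, `ι′ = eSp ∘ ι ∘ eG` ★ `toSp_congr`).
[cite: GelbartRogawski1991, §3.1 p. 454 L21–42, Prop. 3.1.1 p. 455 L1–3] [cite: MoeglinVignerasWaldspurger1987, Chap. 2 II.1 (B)] -/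
theorem proj_congrMp_splitting_apply
    (s : ↥(UnitaryGroup.adelicPair F E c N M (TV.map (algebraMap F E)) (TW.map (algebraMap F E))) →*
      adelicMpCont F (Fin m) (adelicGram F eD TV TW))
    (hs : (splittingDatum F E c N M eD (TV.map (algebraMap F E)) (TW.map (algebraMap F E)) hcδ hδ hd hV hW hVd hWd
      rfl rfl).IsCompatible s)
    (hVs : (PVᵀ * TV * PV).IsSymm) (hWs : ((1 : Matrix (Fin M) (Fin M) F)ᵀ * TW * (1 : Matrix (Fin M) (Fin M) F)).IsSymm)
    (k : ↥(UnitaryGroup.adelic F E c M (((1 : Matrix (Fin M) (Fin M) F)ᵀ * TW * (1 : Matrix (Fin M) (Fin M) F)).map (algebraMap F E))))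
    (v : (Fin m → AdeleRing (𝓞 F) F) × (Fin m → AdeleRing (𝓞 F) F)) :
    ((adelicMpCont.proj F (Fin m) _ (congrMp F eD hVd hWd hPV hPW (s (congrPair F E c N M hPV hPW TV TW
        (adelicInr F E c N M _ _ k)))) : symplecticGroup (polar (adelicForm F (Fin m) (adelicGram F eD (PVᵀ * TV * PV)
          ((1 : Matrix (Fin M) (Fin M) F)ᵀ * TW * (1 : Matrix (Fin M) (Fin M) F)))))) :
        ((Fin m → AdeleRing (𝓞 F) F) × (Fin m → AdeleRing (𝓞 F) F)) ≃ₗ[AdeleRing (𝓞 F) F]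
          ((Fin m → AdeleRing (𝓞 F) F) × (Fin m → AdeleRing (𝓞 F) F))) v =
      ((toSp F E c N M eD _ _ hcδ hδ hd hVs hWs rfl rfl (adelicInr F E c N M _ _ k) :
          symplecticGroup (polar (adelicForm F (Fin m) (adelicGram F eD (PVᵀ * TV * PV)
            ((1 : Matrix (Fin M) (Fin M) F)ᵀ * TW * (1 : Matrix (Fin M) (Fin M) F)))))) :
        ((Fin m → AdeleRing (𝓞 F) F) × (Fin m → AdeleRing (𝓞 F) F)) ≃ₗ[AdeleRing (𝓞 F) F]
          ((Fin m → AdeleRing (𝓞 F) F) × (Fin m → AdeleRing (𝓞 F) F))) v := by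
  have hk : adelicMpCont.proj F (Fin m) _ (congrMp F eD hVd hWd hPV hPW (s (congrPair F E c N M hPV hPW TV TW
      (adelicInr F E c N M _ _ k)))) = toSp F E c N M eD _ _ hcδ hδ hd hVs hWs rfl rfl (adelicInr F E c N M _ _ k) :=
    (proj_congrMp F eD hVd hWd hPV hPW _).trans ((congrArg (congrSp F eD hVd hWd hPV hPW) (hs.1 _)).trans
      (toSp_congr F E c eD hcδ hδ hd hV hW hVd hWd hPV hPW (adelicInr F E c N M _ _ k)).symm)
  exact congrArg (fun X : ↥(symplecticGroup (polar (adelicForm F (Fin m) (adelicGram F eD (PVᵀ * TV * PV)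
      ((1 : Matrix (Fin M) (Fin M) F)ᵀ * TW * (1 : Matrix (Fin M) (Fin M) F)))))) =>
    ((X : ((Fin m → AdeleRing (𝓞 F) F) × (Fin m → AdeleRing (𝓞 F) F)) ≃ₗ[AdeleRing (𝓞 F) F]
      ((Fin m → AdeleRing (𝓞 F) F) × (Fin m → AdeleRing (𝓞 F) F))) v)) hk

/-- **`ũ · φ(y) · ũ⁻¹ = R (q · y · q⁻¹)`, `q = R⁻¹ũ · q_L`**: `φ = R ∘ conj(q_L)` (★ `congrMp_apply`, `leviConj_apply`) and `R` is a group
isomorphism, so a fixed conjugator on the target side folds into a fixed conjugator on the source side.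
[cite: MoeglinVignerasWaldspurger1987, Chap. 2 II.1 (B)] [cite: Weil1964, Chap. I n° 13 p. 160] -/
theorem conj_congrMp_eq_relabel
    (ũ : adelicMpCont F (Fin m) (adelicGram F eD (PVᵀ * TV * PV) ((1 : Matrix (Fin M) (Fin M) F)ᵀ * TW * (1 : Matrix (Fin M) (Fin M) F))))
    (y : adelicMpCont F (Fin m) (adelicGram F eD TV TW)) :
    ũ * congrMp F eD hVd hWd hPV hPW y * ũ⁻¹ = congrMpRelabel F eD hVd hWd hPV hPW
      ((congrMpRelabel F eD hVd hWd hPV hPW).symm ũ * leviPairCont F (adelicGram F eD TV TW) (isUnit_det_adelicGram F eD hVd hWd)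
          (Literature.NumberTheory.Weil1964.ratGL F (gramGL F eD hPV hPW)⁻¹) * y *
        ((congrMpRelabel F eD hVd hWd hPV hPW).symm ũ * leviPairCont F (adelicGram F eD TV TW) (isUnit_det_adelicGram F eD hVd hWd)
          (Literature.NumberTheory.Weil1964.ratGL F (gramGL F eD hPV hPW)⁻¹))⁻¹) := by
  have hqL : congrMp F eD hVd hWd hPV hPW y = congrMpRelabel F eD hVd hWd hPV hPW
      (leviPairCont F (adelicGram F eD TV TW) (isUnit_det_adelicGram F eD hVd hWd)
          (Literature.NumberTheory.Weil1964.ratGL F (gramGL F eD hPV hPW)⁻¹) * y *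
        (leviPairCont F (adelicGram F eD TV TW) (isUnit_det_adelicGram F eD hVd hWd)
          (Literature.NumberTheory.Weil1964.ratGL F (gramGL F eD hPV hPW)⁻¹))⁻¹) :=
    (congrMp_apply F eD hVd hWd hPV hPW y).trans (congrArg _ (leviConj_apply F _ _ _ y))
  have hconjR : ∀ z, ũ * congrMpRelabel F eD hVd hWd hPV hPW z * ũ⁻¹ =
      congrMpRelabel F eD hVd hWd hPV hPW ((congrMpRelabel F eD hVd hWd hPV hPW).symm ũ * z * ((congrMpRelabel F eD hVd hWd hPV hPW).symm ũ)⁻¹) := by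
    intro z
    have e1 : congrMpRelabel F eD hVd hWd hPV hPW ((congrMpRelabel F eD hVd hWd hPV hPW).symm ũ * z * ((congrMpRelabel F eD hVd hWd hPV hPW).symm ũ)⁻¹) =
        congrMpRelabel F eD hVd hWd hPV hPW ((congrMpRelabel F eD hVd hWd hPV hPW).symm ũ * z) * congrMpRelabel F eD hVd hWd hPV hPW (((congrMpRelabel F eD hVd hWd hPV hPW).symm ũ)⁻¹) :=
      MulEquiv.map_mul _ _ _
    have e2 : congrMpRelabel F eD hVd hWd hPV hPW ((congrMpRelabel F eD hVd hWd hPV hPW).symm ũ * z) = congrMpRelabel F eD hVd hWd hPV hPW ((congrMpRelabel F eD hVd hWd hPV hPW).symm ũ) * congrMpRelabel F eD hVd hWd hPV hPW z :=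
      MulEquiv.map_mul _ _ _
    have e3 : congrMpRelabel F eD hVd hWd hPV hPW (((congrMpRelabel F eD hVd hWd hPV hPW).symm ũ)⁻¹) = (congrMpRelabel F eD hVd hWd hPV hPW ((congrMpRelabel F eD hVd hWd hPV hPW).symm ũ))⁻¹ :=
      MulEquiv.map_inv _ _
    have e4 : congrMpRelabel F eD hVd hWd hPV hPW ((congrMpRelabel F eD hVd hWd hPV hPW).symm ũ) = ũ := MulEquiv.apply_symm_apply _ _
    exact ((congrArg (fun t => t * congrMpRelabel F eD hVd hWd hPV hPW z * t⁻¹) e4).symm.trans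
      ((congrArg (fun t => congrMpRelabel F eD hVd hWd hPV hPW ((congrMpRelabel F eD hVd hWd hPV hPW).symm ũ) * congrMpRelabel F eD hVd hWd hPV hPW z * t) e3).symm.trans
        ((congrArg (fun t => t * congrMpRelabel F eD hVd hWd hPV hPW (((congrMpRelabel F eD hVd hWd hPV hPW).symm ũ)⁻¹)) e2).symm.trans e1.symm)))
  have hgrp : ∀ a q z : adelicMpCont F (Fin m) (adelicGram F eD TV TW), a * (q * z * q⁻¹) * a⁻¹ = a * q * z * (a * q)⁻¹ := by
    intro a q z
    simp only [mul_assoc, _root_.mul_inv_rev]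
  exact (congrArg (fun p => ũ * p * ũ⁻¹) hqL).trans ((hconjR _).trans (congrArg (congrMpRelabel F eD hVd hWd hPV hPW) (hgrp _ _ _)))

/-- **`ω(ũ · φ(y) · ũ⁻¹) = ω(q · y · q⁻¹)`** — the relabelling does not move the operator (★ `adelicMpCont.omega_relabel`).
[cite: GelbartRogawski1991, §3.1 p. 454 L21–42] [cite: MoeglinVignerasWaldspurger1987, Chap. 2 II.1 (B)] -/
theorem omega_conj_congrMp
    (ũ : adelicMpCont F (Fin m) (adelicGram F eD (PVᵀ * TV * PV) ((1 : Matrix (Fin M) (Fin M) F)ᵀ * TW * (1 : Matrix (Fin M) (Fin M) F))))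
    (y : adelicMpCont F (Fin m) (adelicGram F eD TV TW)) :
    adelicMpCont.omega F (Fin m) _ (ũ * congrMp F eD hVd hWd hPV hPW y * ũ⁻¹) =
      adelicMpCont.omega F (Fin m) (adelicGram F eD TV TW)
        ((congrMpRelabel F eD hVd hWd hPV hPW).symm ũ * leviPairCont F (adelicGram F eD TV TW) (isUnit_det_adelicGram F eD hVd hWd)
            (Literature.NumberTheory.Weil1964.ratGL F (gramGL F eD hPV hPW)⁻¹) * y *
          ((congrMpRelabel F eD hVd hWd hPV hPW).symm ũ * leviPairCont F (adelicGram F eD TV TW) (isUnit_det_adelicGram F eD hVd hWd)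
            (Literature.NumberTheory.Weil1964.ratGL F (gramGL F eD hPV hPW)⁻¹))⁻¹) :=
  (congrArg (adelicMpCont.omega F (Fin m) _) (conj_congrMp_eq_relabel F N M eD hVd hWd hPV hPW ũ y)).trans
    (adelicMpCont.omega_relabel F (Fin m) _ _ _)

end Congr

/-! ## §2 Lemme 5 transported: the dominated family at congruent diagonal data -/

section Diagonal

variable (F E : Type) [Field F] [NumberField F] [Field E] [NumberField E] [Algebra F E] [Algebra.IsQuadraticExtension F E]
  (c : E ≃ₐ[F] E) {δ : E} (hcδ : c δ = -δ) (hδ : δ ≠ 0) {d : F} (hd : δ * δ = algebraMap F E d)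
  (N M : ℕ) {m : ℕ} (eD : Fin N × Fin M ≃ Fin m)

/-- **THE DOMINATED FAMILY AT CONGRUENT DIAGONAL DATA.**  For diagonal data `(diag t_V, diag t_W)` (entries `≠ 0`; at every real place
of the totally real `F` all but at most one `σ_v(t_W j)` of a common strict sign), a compatible continuous splitting `s` at that data, the
congruence `P = P_V ⊗ 1`, ANY fixed `ũ ∈ Mp_ψ(𝕎′_𝔸)ᶜᵒⁿᵗ`, any `Φ` and any compact `C ⊆ U(1ᵀ diag(t_W) 1)(𝔸_F)`: ONE `Φ₀ ∈ 𝒮(𝔸_F^m)`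
dominates `ω(ũ · φ(s(eG(1 ⊗ k))) · ũ⁻¹)Φ` pointwise for all `k ∈ C` — B-p12's Lemme 5 ★
`exists_piSchwartzBruhat_dominating_omega_conj_pairSplitting_inr_of_signs` at the diagonal data with the fixed conjugator `R⁻¹ũ · q_L`,
read through `omega_conj_congrMp` and `congrPair_adelicInr`.
[cite: Weil1964, Chap. III n° 41, Lemme 5 p. 194] [cite: Weil1965, Chap. V n° 47, n° 50] [cite: GelbartRogawski1991, §3.1 Prop. 3.1.1 p. 455] -/
theorem exists_dominating_conj_congrMp_splitting [IsTotallyReal F] [IsTotallyComplex E]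
    (tV : Fin N → F) (tW : Fin M → F) (hVd : IsUnit (Matrix.diagonal tV).det) (hWd : IsUnit (Matrix.diagonal tW).det)
    (hrk : ∀ v : {v : InfinitePlace F // v.IsReal}, ∃ j₀ : Fin M,
      (∀ j, j ≠ j₀ → 0 < embedding_of_isReal v.2 (tW j)) ∨ ∀ j, j ≠ j₀ → embedding_of_isReal v.2 (tW j) < 0)
    {PV : Matrix (Fin N) (Fin N) F} (hPV : IsUnit PV.det) (hPW : IsUnit (1 : Matrix (Fin M) (Fin M) F).det)
    (s : ↥(UnitaryGroup.adelicPair F E c N M ((Matrix.diagonal tV).map (algebraMap F E)) ((Matrix.diagonal tW).map (algebraMap F E))) →*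
      adelicMpCont F (Fin m) (adelicGram F eD (Matrix.diagonal tV) (Matrix.diagonal tW)))
    (hs : (splittingDatum F E c N M eD ((Matrix.diagonal tV).map (algebraMap F E)) ((Matrix.diagonal tW).map (algebraMap F E)) hcδ hδ hd
      (Matrix.isSymm_diagonal tV) (Matrix.isSymm_diagonal tW) hVd hWd rfl rfl).IsCompatible s)
    (hsc : Continuous s)
    (ũ : adelicMpCont F (Fin m) (adelicGram F eD (PVᵀ * Matrix.diagonal tV * PV) ((1 : Matrix (Fin M) (Fin M) F)ᵀ * Matrix.diagonal tW * (1 : Matrix (Fin M) (Fin M) F))))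
    (Φ : piSchwartzBruhat F (Fin m))
    {C : Set ↥(UnitaryGroup.adelic F E c M (((1 : Matrix (Fin M) (Fin M) F)ᵀ * Matrix.diagonal tW * (1 : Matrix (Fin M) (Fin M) F)).map (algebraMap F E)))}
    (hC : IsCompact C) :
    ∃ Φ₀ : piSchwartzBruhat F (Fin m), ∀ k ∈ C, ∀ x,
      ‖((adelicMpCont.omega F (Fin m) _ (ũ * congrMp F eD hVd hWd hPV hPW (s (congrPair F E c N M hPV hPW (Matrix.diagonal tV)
          (Matrix.diagonal tW) (adelicInr F E c N M _ _ k))) * ũ⁻¹) Φ : piSchwartzBruhat F (Fin m)) :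
          (Fin m → AdeleRing (𝓞 F) F) → ℂ) x‖ ≤
        (((Φ₀ : piSchwartzBruhat F (Fin m)) : (Fin m → AdeleRing (𝓞 F) F) → ℂ) x).re := by
  -- the `W`-side cast `U(1ᵀ diag(t_W) 1) → U(diag t_W)` (same matrices)
  have h1 : (1 : Matrix (Fin M) (Fin M) F)ᵀ * Matrix.diagonal tW * (1 : Matrix (Fin M) (Fin M) F) = Matrix.diagonal tW := by
    rw [Matrix.transpose_one, Matrix.one_mul, Matrix.mul_one]
  have hmemW : ∀ k0 : GL (Fin M) (AdeleRing (𝓞 E) E),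
      k0 ∈ UnitaryGroup.adelic F E c M (((1 : Matrix (Fin M) (Fin M) F)ᵀ * Matrix.diagonal tW * (1 : Matrix (Fin M) (Fin M) F)).map (algebraMap F E)) →
        k0 ∈ UnitaryGroup.adelic F E c M ((Matrix.diagonal tW).map (algebraMap F E)) := fun k0 hk0 => by
    rwa [h1] at hk0
  let kW : ↥(UnitaryGroup.adelic F E c M (((1 : Matrix (Fin M) (Fin M) F)ᵀ * Matrix.diagonal tW * (1 : Matrix (Fin M) (Fin M) F)).map
      (algebraMap F E))) → ↥(UnitaryGroup.adelic F E c M ((Matrix.diagonal tW).map (algebraMap F E))) :=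
    fun k => ⟨k.1, hmemW k.1 k.2⟩
  have hkW : Continuous kW := continuous_subtype_val.subtype_mk _
  have hC₀ : IsCompact (kW '' C) := hC.image hkW
  -- Lemme 5 at the diagonal data, fixed conjugator `q := R⁻¹ ũ · q_L`
  have hL5 := exists_piSchwartzBruhat_dominating_omega_conj_pairSplitting_inr_of_signs E c N M eD tV tW
    (JV := (Matrix.diagonal tV).map (algebraMap F E)) (JW := (Matrix.diagonal tW).map (algebraMap F E)) rfl rfl hcδ hδ hd
    (Matrix.isSymm_diagonal tV) (Matrix.isSymm_diagonal tW) (conj_ne_one F E c hcδ hδ)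
    (fun v => placeAboveOne F E ⟨v, isTypeOne_of_isTotallyComplex F E v⟩) (fun v => smul_placeAboveOne F E c _)
    (fun v => placeAboveOne_comap F E _) hVd hWd hrk hs hsc
    ((congrMpRelabel F eD hVd hWd hPV hPW).symm ũ * leviPairCont F (adelicGram F eD (Matrix.diagonal tV) (Matrix.diagonal tW))
      (isUnit_det_adelicGram F eD hVd hWd) (Literature.NumberTheory.Weil1964.ratGL F (gramGL F eD hPV hPW)⁻¹)) Φ hC₀
  rcases hL5 with ⟨Φ₀, hΦ₀, -, hdom⟩
  refine ⟨⟨Φ₀, hΦ₀⟩, fun k hk x => ?_⟩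
  -- `s(eG(1 ⊗ k)) = s_pair(1, k)`
  have hpair : adelicInl F E c N M ((Matrix.diagonal tV).map (algebraMap F E)) ((Matrix.diagonal tW).map (algebraMap F E)) 1 *
      adelicInr F E c N M _ _ (kW k) = adelicInr F E c N M _ _ (kW k) := by
    rw [map_one, one_mul]
  have hy : s (congrPair F E c N M hPV hPW (Matrix.diagonal tV) (Matrix.diagonal tW) (adelicInr F E c N M _ _ k)) =
      pairSplitting F E c N M eD _ _ s (1, kW k) :=
    (congrArg s (congrPair_adelicInr F E c N M hPV hPW k (kW k) rfl)).trans
      ((pairSplitting_apply F E c N M eD _ _ s (1, kW k)).trans (congrArg s hpair)).symm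
  have hω := omega_conj_congrMp F N M eD hVd hWd hPV hPW ũ
    (s (congrPair F E c N M hPV hPW (Matrix.diagonal tV) (Matrix.diagonal tW) (adelicInr F E c N M _ _ k)))
  have hω' := hω.trans (congrArg (fun y' => adelicMpCont.omega F (Fin m) (adelicGram F eD (Matrix.diagonal tV) (Matrix.diagonal tW))
    ((congrMpRelabel F eD hVd hWd hPV hPW).symm ũ * leviPairCont F (adelicGram F eD (Matrix.diagonal tV) (Matrix.diagonal tW))
        (isUnit_det_adelicGram F eD hVd hWd) (Literature.NumberTheory.Weil1964.ratGL F (gramGL F eD hPV hPW)⁻¹) * y' *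
      ((congrMpRelabel F eD hVd hWd hPV hPW).symm ũ * leviPairCont F (adelicGram F eD (Matrix.diagonal tV) (Matrix.diagonal tW))
        (isUnit_det_adelicGram F eD hVd hWd) (Literature.NumberTheory.Weil1964.ratGL F (gramGL F eD hPV hPW)⁻¹))⁻¹)) hy)
  exact (congrArg (fun L : piSchwartzBruhat F (Fin m) →ₗ[ℂ] piSchwartzBruhat F (Fin m) =>
      ‖((L Φ : piSchwartzBruhat F (Fin m)) : (Fin m → AdeleRing (𝓞 F) F) → ℂ) x‖) hω').trans_le
    (hdom (kW k) (Set.mem_image_of_mem kW hk) x)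

/-- **THE IMPLEMENTER HOM AT CONGRUENT DIAGONAL DATA** (syntactic form): `S := φ ∘ s ∘ eG ∘ (1 ⊗ ·)` is a continuous homomorphism
`U(1ᵀ diag(t_W) 1)(𝔸_F) →* Mp_ψ(𝕎′_𝔸)ᶜᵒⁿᵗ` over `ι′(1 ⊗ ·)` whose conjugates by any fixed `ũ` are Lemme-5-dominated on compacta
(`s` = ★ `UnitaryDualPair.compatibleSplitting_splittingDatum` at the diagonal data).
[cite: GelbartRogawski1991, §3.1 Prop. 3.1.1 p. 455 L1–3] [cite: Weil1964, Chap. III n° 41, Lemme 5 p. 194] -/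
theorem exists_implementerHom_diagonal [IsTotallyReal F] [IsTotallyComplex E]
    (tV : Fin N → F) (tW : Fin M → F) (htV : ∀ i, tV i ≠ 0) (htW : ∀ j, tW j ≠ 0)
    (hrk : ∀ v : {v : InfinitePlace F // v.IsReal}, ∃ j₀ : Fin M,
      (∀ j, j ≠ j₀ → 0 < embedding_of_isReal v.2 (tW j)) ∨ ∀ j, j ≠ j₀ → embedding_of_isReal v.2 (tW j) < 0)
    {PV : Matrix (Fin N) (Fin N) F} (hPV : IsUnit PV.det)
    (hVs : (PVᵀ * Matrix.diagonal tV * PV).IsSymm) (hWs : ((1 : Matrix (Fin M) (Fin M) F)ᵀ * Matrix.diagonal tW * (1 : Matrix (Fin M) (Fin M) F)).IsSymm) :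
    ∃ S : ↥(UnitaryGroup.adelic F E c M (((1 : Matrix (Fin M) (Fin M) F)ᵀ * Matrix.diagonal tW * (1 : Matrix (Fin M) (Fin M) F)).map (algebraMap F E))) →*
        adelicMpCont F (Fin m) (adelicGram F eD (PVᵀ * Matrix.diagonal tV * PV) ((1 : Matrix (Fin M) (Fin M) F)ᵀ * Matrix.diagonal tW * (1 : Matrix (Fin M) (Fin M) F))),
      Continuous S ∧
      (∀ (k : ↥(UnitaryGroup.adelic F E c M (((1 : Matrix (Fin M) (Fin M) F)ᵀ * Matrix.diagonal tW * (1 : Matrix (Fin M) (Fin M) F)).map (algebraMap F E))))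
          (v : (Fin m → AdeleRing (𝓞 F) F) × (Fin m → AdeleRing (𝓞 F) F)),
        ((adelicMpCont.proj F (Fin m) _ (S k) : symplecticGroup (polar (adelicForm F (Fin m) (adelicGram F eD
            (PVᵀ * Matrix.diagonal tV * PV) ((1 : Matrix (Fin M) (Fin M) F)ᵀ * Matrix.diagonal tW * (1 : Matrix (Fin M) (Fin M) F)))))) :
            ((Fin m → AdeleRing (𝓞 F) F) × (Fin m → AdeleRing (𝓞 F) F)) ≃ₗ[AdeleRing (𝓞 F) F]
              ((Fin m → AdeleRing (𝓞 F) F) × (Fin m → AdeleRing (𝓞 F) F))) v =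
          ((toSp F E c N M eD _ _ hcδ hδ hd hVs hWs rfl rfl (adelicInr F E c N M _ _ k) :
              symplecticGroup (polar (adelicForm F (Fin m) (adelicGram F eD
                (PVᵀ * Matrix.diagonal tV * PV) ((1 : Matrix (Fin M) (Fin M) F)ᵀ * Matrix.diagonal tW * (1 : Matrix (Fin M) (Fin M) F)))))) :
            ((Fin m → AdeleRing (𝓞 F) F) × (Fin m → AdeleRing (𝓞 F) F)) ≃ₗ[AdeleRing (𝓞 F) F]
              ((Fin m → AdeleRing (𝓞 F) F) × (Fin m → AdeleRing (𝓞 F) F))) v) ∧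
      ∀ (ũ : adelicMpCont F (Fin m) (adelicGram F eD (PVᵀ * Matrix.diagonal tV * PV)
          ((1 : Matrix (Fin M) (Fin M) F)ᵀ * Matrix.diagonal tW * (1 : Matrix (Fin M) (Fin M) F)))) (Φ : piSchwartzBruhat F (Fin m))
        (C : Set ↥(UnitaryGroup.adelic F E c M (((1 : Matrix (Fin M) (Fin M) F)ᵀ * Matrix.diagonal tW * (1 : Matrix (Fin M) (Fin M) F)).map
          (algebraMap F E)))),
        IsCompact C → ∃ Φ₀ : piSchwartzBruhat F (Fin m), ∀ k ∈ C, ∀ x,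
          ‖((adelicMpCont.omega F (Fin m) _ (ũ * S k * ũ⁻¹) Φ : piSchwartzBruhat F (Fin m)) :
              (Fin m → AdeleRing (𝓞 F) F) → ℂ) x‖ ≤
            (((Φ₀ : piSchwartzBruhat F (Fin m)) : (Fin m → AdeleRing (𝓞 F) F) → ℂ) x).re := by
  have hVd : IsUnit (Matrix.diagonal tV).det := Prop311.isUnit_det_diagonal_of_ne_zero tV htV
  have hWd : IsUnit (Matrix.diagonal tW).det := Prop311.isUnit_det_diagonal_of_ne_zero tW htW
  have hPW : IsUnit (1 : Matrix (Fin M) (Fin M) F).det := by rw [Matrix.det_one]; exact isUnit_one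
  -- [GR91, Prop. 3.1.1] at the diagonal data (`have`-then-`rcases`: `obtain` on the term runs `isTypeCorrect` and times out)
  have hGR := compatibleSplitting_splittingDatum F E c N M eD hcδ hδ hd (Matrix.isSymm_diagonal tV)
    (Matrix.isSymm_diagonal tW) hVd hWd (JV := (Matrix.diagonal tV).map (algebraMap F E))
    (JW := (Matrix.diagonal tW).map (algebraMap F E)) rfl rfl
  rcases hGR with ⟨s, hsc, hs⟩
  refine ⟨(congrMp F eD hVd hWd hPV hPW).comp (s.comp ((congrPair F E c N M hPV hPW (Matrix.diagonal tV)
      (Matrix.diagonal tW)).toMonoidHom.comp (adelicInr F E c N M _ _))), ?_, fun k v => ?_, fun ũ Φ C hC => ?_⟩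
  · exact (continuous_congrMp F eD hVd hWd hPV hPW).comp (hsc.comp ((congrPair F E c N M hPV hPW (Matrix.diagonal tV)
      (Matrix.diagonal tW)).continuous.comp (continuous_adelicInr F E c N M _ _)))
  · exact proj_congrMp_splitting_apply F E c hcδ hδ hd N M eD (Matrix.isSymm_diagonal tV) (Matrix.isSymm_diagonal tW) hVd hWd
      hPV hPW s hs hVs hWs k v
  · exact exists_dominating_conj_congrMp_splitting F E c hcδ hδ hd N M eD tV tW hVd hWd hrk hPV hPW s hs hsc ũ Φ hC

/-- **THE IMPLEMENTER HOM — EQUATION-BINDER FORM.**  `exists_implementerHom_diagonal` with the target data `(T_V′, T_W′)` and the target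
Gram matrix `T′` entered as EQUATIONS `P_Vᵀ diag(t_V) P_V = T_V′`, `1ᵀ diag(t_W) 1 = T_W′`, `adelicGram e□ T_V′ T_W′ = T′` (so that a consumer
instantiates at its own syntactic forms, e.g. `T′ := doubledGramFin …`; proof: `subst`).
[cite: GelbartRogawski1991, §3.1 Prop. 3.1.1 p. 455 L1–3] [cite: Weil1964, Chap. III n° 41, Lemme 5 p. 194] -/
theorem exists_implementerHom_of_congr [IsTotallyReal F] [IsTotallyComplex E]
    (tV : Fin N → F) (tW : Fin M → F) (htV : ∀ i, tV i ≠ 0) (htW : ∀ j, tW j ≠ 0)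
    (hrk : ∀ v : {v : InfinitePlace F // v.IsReal}, ∃ j₀ : Fin M,
      (∀ j, j ≠ j₀ → 0 < embedding_of_isReal v.2 (tW j)) ∨ ∀ j, j ≠ j₀ → embedding_of_isReal v.2 (tW j) < 0)
    {PV : Matrix (Fin N) (Fin N) F} (hPV : IsUnit PV.det)
    {TV' : Matrix (Fin N) (Fin N) F} {TW' : Matrix (Fin M) (Fin M) F}
    (hV' : PVᵀ * Matrix.diagonal tV * PV = TV')
    (hW' : (1 : Matrix (Fin M) (Fin M) F)ᵀ * Matrix.diagonal tW * (1 : Matrix (Fin M) (Fin M) F) = TW')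
    (hVs : TV'.IsSymm) (hWs : TW'.IsSymm)
    {T' : Matrix (Fin m) (Fin m) (AdeleRing (𝓞 F) F)} (hT' : adelicGram F eD TV' TW' = T') :
    ∃ S : ↥(UnitaryGroup.adelic F E c M (TW'.map (algebraMap F E))) →* adelicMpCont F (Fin m) T',
      Continuous S ∧
      (∀ (k : ↥(UnitaryGroup.adelic F E c M (TW'.map (algebraMap F E))))
          (v : (Fin m → AdeleRing (𝓞 F) F) × (Fin m → AdeleRing (𝓞 F) F)),
        ((adelicMpCont.proj F (Fin m) T' (S k) : symplecticGroup (polar (adelicForm F (Fin m) T'))) :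
            ((Fin m → AdeleRing (𝓞 F) F) × (Fin m → AdeleRing (𝓞 F) F)) ≃ₗ[AdeleRing (𝓞 F) F]
              ((Fin m → AdeleRing (𝓞 F) F) × (Fin m → AdeleRing (𝓞 F) F))) v =
          ((toSp F E c N M eD (TV'.map (algebraMap F E)) (TW'.map (algebraMap F E)) hcδ hδ hd hVs hWs rfl rfl
              (adelicInr F E c N M (TV'.map (algebraMap F E)) (TW'.map (algebraMap F E)) k) :
              symplecticGroup (polar (adelicForm F (Fin m) (adelicGram F eD TV' TW')))) :
            ((Fin m → AdeleRing (𝓞 F) F) × (Fin m → AdeleRing (𝓞 F) F)) ≃ₗ[AdeleRing (𝓞 F) F]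
              ((Fin m → AdeleRing (𝓞 F) F) × (Fin m → AdeleRing (𝓞 F) F))) v) ∧
      ∀ (ũ : adelicMpCont F (Fin m) T') (Φ : piSchwartzBruhat F (Fin m)) (C : Set ↥(UnitaryGroup.adelic F E c M (TW'.map (algebraMap F E)))),
        IsCompact C → ∃ Φ₀ : piSchwartzBruhat F (Fin m), ∀ k ∈ C, ∀ x,
          ‖((adelicMpCont.omega F (Fin m) T' (ũ * S k * ũ⁻¹) Φ : piSchwartzBruhat F (Fin m)) :
              (Fin m → AdeleRing (𝓞 F) F) → ℂ) x‖ ≤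
            (((Φ₀ : piSchwartzBruhat F (Fin m)) : (Fin m → AdeleRing (𝓞 F) F) → ℂ) x).re := by
  subst hV' hW' hT'
  exact exists_implementerHom_diagonal F E c hcδ hδ hd N M eD tV tW htV htW hrk hPV hVs hWs

end Diagonal

end Summit.HodgeConjecture.HodgeConjecture.Cruxes.H413.E2SWBorelBoundLettersCongr

end
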